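/-
Copyright (c) 2026 the pub-hodgecm-mathlib formalisation cell (harness21).  Prover seat hodgecm-mathlib-K2Liu-p09 (g6): Track B «K2-LIT»,
hLiu418 = stmt-HodgeConjecture-24832; LEAD F0P6-plan RULING M-158d «A7-val road (σ)», instance layer I-3c (the Siegel law `hSiegB`: `f^Δ_Ψ ∈ I_v((M₂−n)∕2, χ^{M₂})`).
-/
import Summits.HodgeConjecture.HodgeConjecture.Theorems.K2LiuLocalSWSectionSiegelLaw        -- ★ (S4-law) (K2Liu-p09 g5): `localSWImage_le_localDegPS_pow` (brings (S4-glob) record pair)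
import Summits.HodgeConjecture.HodgeConjecture.Theorems.K2LiuLocalSWImageMoverInvariance    -- ★ (β-3∕mover) (K2Liu-p09 g5): `exists_ne_zero_swSectionLoc_eq_mul_swSectionDelta`, `record_isMover`
import HarnessLib

/-!
# Crux `HLiu418`, road `K2_Liu`, organ A7-val, instance layer I-3c: THE SIEGEL LAW OF THE FACE'S BIG SECTION — `f^Δ_Ψ|_{H_v} ∈ I_v((M₂ − n)∕2, (χ^{M₂})_v)`

Cell `hodgecm-mathlib`, crux item hLiu418 = `stmt-HodgeConjecture-24832`; squad K2 ∕ K2Liu; prover K2Liu-p09 (g6), organ lead A7-val.  THEOREMS ONLY; lane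
`--supports stmt-HodgeConjecture-24832` (count-neutral helper).  Setting of ★ I-3a∕b with the WEIL DATUM OF RECORD: the K2Lit CM datum `(L, e, dV, dW)`,
`V′ = (L^{M₂}, diag dV′)`, frames `(eW, e′)`, a global Hecke character `χ` with place measures `𝔪` and a finite local family `𝓕` of the big datum `𝔻 ⊗ V′`
(★ (S4-glob)): the CM-model splitting of record `s_𝔻 := (finSplittings …).s v` and the record pair `m₀,v = (δ_v, M_v)`; a Δ-intertwiner `Γ` normalised by
`(Γ Φ)(0) = ∫ Φ(u ⊔ u) dμ(u)` (★ β-3 `exists_isDeltaIntertwiner_apply_zero`); `s^Δ_B := mpTransportLoc Γ ∘ s_𝔻 ∘ tensorEmbLoc` over `H_v`.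
* **`swSectionDelta_transport_eq_inv_mul_swSectionTensorLoc`**: `f^Δ_Ψ(h) = c⁻¹ · F_{Γ⁻¹Ψ}(h)` with the constant `c ≠ 0` of ★ `exists_ne_zero_swSectionLoc_eq_mul_swSectionDelta`
  (the record pair is a mover, ★ `record_isMover`) — the face's big section in the Δ-model IS the (S1) local Siegel–Weil section up to `c`.
* **`swSectionDelta_transport_mem_localDegPS`** — THE BINDER `hSiegB` of ★ V8e at the instance (the target of `𝒜 : Φ ↦ f^Δ_Φ`): `f^Δ_Ψ|_{H_v} ∈ localDegPS …
  (χ^{M₂})_v ((M₂ − n)∕2)` (★ (S4-law) `localSWImage_le_localDegPS_pow`; for `n = 2`, `M₂ = 3`: `I_v(½, χ³_v)`).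
HONEST LABEL.  `HC_CM` is proved only modulo the 7 printed citations (2 remaining named inputs: hLiu418 = `stmt-HodgeConjecture-24832`,
h413 = `stmt-HodgeConjecture-24833`) until rung 0 closes.

## References
* [KudlaRallis1994] S. Kudla, S. Rallis, Ann. of Math. 140 (1994), §1 (the Siegel–Weil section `Φ ↦ f_Φ ∈ I(s₀, χ)`).
* [GanQiuTakeda2014] W. T. Gan, Y. Qiu, S. Takeda, Invent. Math. 198 (2014), §5.4–§5.5.
* [MoeglinVignerasWaldspurger1987] C. Mœglin, M.-F. Vignéras, J.-L. Waldspurger, LNM 1291, Chap. 2 I.7, II.6.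
-/

set_option autoImplicit false
set_option linter.dupNamespace false -- the mandated namespace repeats `HodgeConjecture.HodgeConjecture`

noncomputable section

open scoped Matrix TensorProduct Classical
open NumberField IsDedekindDomain Filter MeasureTheory
open Literature.RepresentationTheory.HeisenbergGroup
open Literature.NumberTheory.Automorphic Literature.NumberTheory.Automorphic.UnitaryGroup Literature.NumberTheory.GaloisRepresentations
open Literature.NumberTheory.Weil1964 Literature.RepresentationTheory.HarrisKudlaSweet1996
open Literature.NumberTheory.GelbartRogawski1991 Literature.NumberTheory.GelbartRogawski1991.GRConstruction
open Literature.NumberTheory.GelbartRogawski1991.UnitaryDualPair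
open Literature.NumberTheory.GelbartRogawski1991.UnitaryDualPair.LocalSplitting
open Literature.NumberTheory.K2Lit.SiegelDoubled Literature.NumberTheory.K2Lit.LocalSiegelDoubled
open Summit.HodgeConjecture.HodgeConjecture.Cruxes.HLiu418.K2LiuDoublingSchrodingerModelDefs
open Summit.HodgeConjecture.HodgeConjecture.Cruxes.HLiu418.K2LiuDoublingModelComparison
open Summit.HodgeConjecture.HodgeConjecture.Cruxes.HLiu418.K2LiuLocalSWSectionDefs
open Summit.HodgeConjecture.HodgeConjecture.Cruxes.HLiu418.K2LiuLocalSWImageDefs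
open Summit.HodgeConjecture.HodgeConjecture.Cruxes.HLiu418.K2LiuSWSectionPlaceFactorisation
open Summit.HodgeConjecture.HodgeConjecture.Cruxes.HLiu418.K2LiuSWSectionTensorPlaceFactorisation
open Summit.HodgeConjecture.HodgeConjecture.Cruxes.HLiu418.K2LiuLocalSWSectionSiegelLaw
open Summit.HodgeConjecture.HodgeConjecture.Cruxes.HLiu418.K2LiuLocalSWImageMoverInvariance

namespace Summit.HodgeConjecture.HodgeConjecture.Cruxes.HLiu418.K2LiuA7ValueInstanceSiegelLaw

variable (L : Type) [Field L] [NumberField L] [IsCMField L]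
variable {N M n : ℕ} (e : Fin N × Fin M ≃ Fin n)
  (dV : Fin N → L) (hdV : ∀ i, IsCMField.complexConj L (dV i) = dV i) (hdV0 : ∀ i, dV i ≠ 0)
  (dW : Fin M → L) (hdW : ∀ i, IsCMField.complexConj L (dW i) = dW i) (hdW0 : ∀ i, dW i ≠ 0)
variable {M₂ M' n' : ℕ} (eW : Fin M × Fin M₂ ≃ Fin M') (e' : Fin N × Fin M' ≃ Fin n')
  (dV' : Fin M₂ → L) (hdV' : ∀ k, IsCMField.complexConj L (dV' k) = dV' k) (hdV'0 : ∀ k, dV' k ≠ 0)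
variable (χ : HeckeCharacter L) (𝔪 : ∀ v, PlaceMeasure L v)
  (𝓕 : FinLocalFamily L e' dV hdV hdV0 (tensorFrame L dW eW dV') (tensorFrame_real L dW hdW eW dV' hdV') (tensorFrame_ne_zero L dW eW dV' hdW0 hdV'0) χ 𝔪)
  (v : HeightOneSpectrum (𝓞 (Fp L)))
  [MeasurableSpace (Fin n' → v.adicCompletion (Fp L))] [BorelSpace (Fin n' → v.adicCompletion (Fp L))]
  (μ : Measure (Fin n' → v.adicCompletion (Fp L))) [μ.IsAddHaarMeasure]
  (Γ : SchwartzBruhat (Fin (n' + n') → v.adicCompletion (Fp L)) ≃ₗ[ℂ] SchwartzBruhat (Fin (n' + n') → v.adicCompletion (Fp L)))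
  (hΓ : IsDeltaIntertwiner L e' dV hdV (tensorFrame L dW eW dV') (tensorFrame_real L dW hdW eW dV' hdV') v Γ)
  (hΓ0 : ∀ Ψ : SchwartzBruhat (Fin (n' + n') → v.adicCompletion (Fp L)),
    ((Γ Ψ : SchwartzBruhat (Fin (n' + n') → v.adicCompletion (Fp L))) : (Fin (n' + n') → v.adicCompletion (Fp L)) → ℂ) 0 =
      diagIntegral (GRConstruction.e₂ (n := n')) μ Ψ)

set_option maxHeartbeats 800000 in -- measured > 200 000: the explicit record pair `m₀,v` in the statement (as ★ (S4-law) §3, ★ (β-3∕mover) §3)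
include hdW0 hdV'0 hΓ0 in
/-- **`f^Δ_Ψ(h) = c⁻¹ · F_{Γ⁻¹ Ψ}(h)`, `c ≠ 0`**: the face's big section in the Δ-model along `s^Δ_B = mpTransportLoc Γ ∘ s_𝔻 ∘ tensorEmbLoc` is a NON-ZERO constant multiple
of the (S1) local Siegel–Weil section of record `F_φ = swSectionTensorLoc v s_𝔻 m₀,v φ` at `φ := Γ⁻¹ Ψ` (★ `exists_ne_zero_swSectionLoc_eq_mul_swSectionDelta` at the big datum —
the record pair is a mover, ★ `record_isMover` — read at the element `h ⊗ 1`). [cite: KudlaRallis1994, §1] [cite: MoeglinVignerasWaldspurger1987, Chap. 2 II.6] -/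
theorem exists_swSectionDelta_transport_eq_mul_swSectionTensorLoc :
    ∃ c : ℂ, c ≠ 0 ∧ ∀ (Ψ : SchwartzBruhat (Fin (n' + n') → v.adicCompletion (Fp L)))
      (h : UnitaryGroup.localPi L (IsCMField.complexConj L) (n + n) (hermD L e dV hdV dW hdW) v),
      swSectionDelta L e' dV hdV (tensorFrame L dW eW dV') (tensorFrame_real L dW hdW eW dV' hdV') v
          ((mpTransportLoc L e' dV hdV (tensorFrame L dW eW dV') (tensorFrame_real L dW hdW eW dV' hdV') v Γ hΓ).toMonoidHom.comp
            (((finSplittings L e' dV hdV hdV0 (tensorFrame L dW eW dV') (tensorFrame_real L dW hdW eW dV' hdV') (tensorFrame_ne_zero L dW eW dV' hdW0 hdV'0) χ 𝔪 𝓕).s v).comp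
              (tensorEmbLoc L e dV hdV dW hdW eW e' dV' hdV' v))) Ψ h =
        c⁻¹ * swSectionTensorLoc L e dV hdV dW hdW eW e' dV' hdV' v
          ((finSplittings L e' dV hdV hdV0 (tensorFrame L dW eW dV') (tensorFrame_real L dW hdW eW dV' hdV') (tensorFrame_ne_zero L dW eW dV' hdW0 hdV'0) χ 𝔪 𝓕).s v)
          ⟨(ratSpLoc (Fp L) (n' + n') (gramD L e' dV hdV (tensorFrame L dW eW dV') (tensorFrame_real L dW hdW eW dV' hdV'))
                (isUnit_det_gramD L e' dV hdV hdV0 (tensorFrame L dW eW dV') (tensorFrame_real L dW hdW eW dV' hdV') (tensorFrame_ne_zero L dW eW dV' hdW0 hdV'0)) v (deltaD L),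
              deltaImpl L e' dV hdV hdV0 (tensorFrame L dW eW dV') (tensorFrame_real L dW hdW eW dV' hdV') (tensorFrame_ne_zero L dW eW dV' hdW0 hdV'0) χ 𝔪 𝓕 v),
            deltaPair_mem_localMp L e' dV hdV hdV0 (tensorFrame L dW eW dV') (tensorFrame_real L dW hdW eW dV' hdV') (tensorFrame_ne_zero L dW eW dV' hdW0 hdV'0) χ 𝔪 𝓕 v⟩
          (Γ.symm Ψ) h := by
  obtain ⟨c, hc0, hc⟩ := exists_ne_zero_swSectionLoc_eq_mul_swSectionDelta L e' dV hdV hdV0 (tensorFrame L dW eW dV') (tensorFrame_real L dW hdW eW dV' hdV')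
    (tensorFrame_ne_zero L dW eW dV' hdW0 hdV'0) v μ _
    (record_isMover (hdV0 := hdV0) (hdW0 := hdW0) (hdV'0 := hdV'0) L dV hdV dW hdW eW e' dV' hdV' v χ 𝔪 𝓕) Γ hΓ hΓ0
  refine ⟨c, hc0, fun Ψ h => ?_⟩
  have key := hc ((finSplittings L e' dV hdV hdV0 (tensorFrame L dW eW dV') (tensorFrame_real L dW hdW eW dV' hdV') (tensorFrame_ne_zero L dW eW dV' hdW0 hdV'0) χ 𝔪 𝓕).s v)
    (Γ.symm Ψ) (tensorEmbLoc L e dV hdV dW hdW eW e' dV' hdV' v h)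
  rw [LinearEquiv.apply_symm_apply] at key
  rw [swSectionTensorLoc_apply, key, ← mul_assoc, inv_mul_cancel₀ hc0, one_mul]
  rfl

set_option maxHeartbeats 800000 in -- as above
include hdW0 hdV'0 μ hΓ0 in
/-- **`hSiegB` AT THE INSTANCE: `f^Δ_Ψ|_{H_v} ∈ I_v((M₂ − n)∕2, (χ^{M₂})_v)`** — the face's big section (restricted to `H_v` along `s^Δ_B`) lies in the K2Lit degenerate principal
series ★ `localDegPS … (χ^{M₂})_v ((M₂ − n)∕2)`: it is `c⁻¹ · F_{Γ⁻¹Ψ}` (above) and `F_φ ∈ R(V′_v) ≤ I_v` (★ (S4-law) `localSWImage_le_localDegPS_pow`).  For `n = 2`, `M₂ = 3`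
this is the `localDegPS … χ_v (½)`-valuedness of `𝒜 : Φ ↦ f^Δ_Φ` demanded by ★ V8e. [cite: KudlaRallis1994, §1] [cite: GanQiuTakeda2014, §5.4–§5.5] -/
theorem swSectionDelta_transport_mem_localDegPS [Algebra.IsQuadraticExtension (Fp L) L] (hM₂ : M₂ ≠ 0)
    (Ψ : SchwartzBruhat (Fin (n' + n') → v.adicCompletion (Fp L))) :
    swSectionDelta L e' dV hdV (tensorFrame L dW eW dV') (tensorFrame_real L dW hdW eW dV' hdV') v
        ((mpTransportLoc L e' dV hdV (tensorFrame L dW eW dV') (tensorFrame_real L dW hdW eW dV' hdV') v Γ hΓ).toMonoidHom.comp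
          (((finSplittings L e' dV hdV hdV0 (tensorFrame L dW eW dV') (tensorFrame_real L dW hdW eW dV' hdV') (tensorFrame_ne_zero L dW eW dV' hdW0 hdV'0) χ 𝔪 𝓕).s v).comp
            (tensorEmbLoc L e dV hdV dW hdW eW e' dV' hdV' v))) Ψ ∈
      localDegPS (Fp L) L (IsCMField.complexConj L) (complexConj_imagUnit L) (imagUnit_ne_zero L) (imagUnit_mul_self L)
        v n (gramR_isSymm L e dV hdV dW hdW) (hermD_eq_map_gramD L e dV hdV dW hdW) (fun w => (χ ^ M₂).localComponent w.1) (((M₂ : ℂ) - (n : ℂ)) / 2) := by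
  obtain ⟨c, hc0, hc⟩ := exists_swSectionDelta_transport_eq_mul_swSectionTensorLoc L e dV hdV hdV0 dW hdW hdW0 eW e' dV' hdV' hdV'0 χ 𝔪 𝓕 v μ Γ hΓ hΓ0
  have hfun : swSectionDelta L e' dV hdV (tensorFrame L dW eW dV') (tensorFrame_real L dW hdW eW dV' hdV') v
        ((mpTransportLoc L e' dV hdV (tensorFrame L dW eW dV') (tensorFrame_real L dW hdW eW dV' hdV') v Γ hΓ).toMonoidHom.comp
          (((finSplittings L e' dV hdV hdV0 (tensorFrame L dW eW dV') (tensorFrame_real L dW hdW eW dV' hdV') (tensorFrame_ne_zero L dW eW dV' hdW0 hdV'0) χ 𝔪 𝓕).s v).comp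
            (tensorEmbLoc L e dV hdV dW hdW eW e' dV' hdV' v))) Ψ =
      c⁻¹ • swSectionTensorLoc L e dV hdV dW hdW eW e' dV' hdV' v
          ((finSplittings L e' dV hdV hdV0 (tensorFrame L dW eW dV') (tensorFrame_real L dW hdW eW dV' hdV') (tensorFrame_ne_zero L dW eW dV' hdW0 hdV'0) χ 𝔪 𝓕).s v)
          ⟨(ratSpLoc (Fp L) (n' + n') (gramD L e' dV hdV (tensorFrame L dW eW dV') (tensorFrame_real L dW hdW eW dV' hdV'))
                (isUnit_det_gramD L e' dV hdV hdV0 (tensorFrame L dW eW dV') (tensorFrame_real L dW hdW eW dV' hdV') (tensorFrame_ne_zero L dW eW dV' hdW0 hdV'0)) v (deltaD L),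
              deltaImpl L e' dV hdV hdV0 (tensorFrame L dW eW dV') (tensorFrame_real L dW hdW eW dV' hdV') (tensorFrame_ne_zero L dW eW dV' hdW0 hdV'0) χ 𝔪 𝓕 v),
            deltaPair_mem_localMp L e' dV hdV hdV0 (tensorFrame L dW eW dV') (tensorFrame_real L dW hdW eW dV' hdV') (tensorFrame_ne_zero L dW eW dV' hdW0 hdV'0) χ 𝔪 𝓕 v⟩
          (Γ.symm Ψ) :=
    funext fun h => by rw [Pi.smul_apply, smul_eq_mul]; exact hc Ψ h
  rw [hfun]
  exact Submodule.smul_mem _ _ (localSWImage_le_localDegPS_pow L e dV hdV hdV0 dW hdW hdW0 eW e' dV' hdV' hdV'0 χ 𝔪 𝓕 v hM₂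
    (swSectionTensorLoc_mem_localSWImage L e dV hdV dW hdW eW e' dV' hdV' v _ _ (Γ.symm Ψ)))

end Summit.HodgeConjecture.HodgeConjecture.Cruxes.HLiu418.K2LiuA7ValueInstanceSiegelLaw

end
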